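import Mathlib
import Summits.CriticalPhenomena.SAWScalingLimit.Theorems.SAWDefectDecoherenceObservableToSLERGateTransferCells
import Summits.CriticalPhenomena.SAWScalingLimit.Theorems.SAWDefectDecoherenceObservableToSLERGateTransferPolyline

/-!
# Gate transfer, assembly 2: the exact factorisation on a cylinder, pushed to curves

Support file for the stub `stub_gateTransfer` (the gate transfer
`GateDecomposition → RenewalAccumulation → CarvedToSLE → HexTight → FullIdentification`) of the
line `bridge-gate-renewal` for the crux
`Summit.CriticalPhenomena.SAWScalingLimit.Theses.SAWDefectDecoherence.ObservableToSLER`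
(item `stmt-CriticalPhenomena-14005`).

* `polyClass`, `GateLabel.midCurve` (the middle curve of a walk), `carvedWeight_union`;
* `map_midCurve_restrict_cyl` — under `GateDecomposition` for the cylinder data, the law of the
  middle curve under the critical weight restricted to the cylinder is `x_c^{|l₁|+|l₂|}` times the
  law of the curve under the carved weight; integral and mass forms; the per-cell identity for
  `hexSAWLaw` (registered sub-goal `stub_perCellIdentity`).
-/

noncomputable section

open scoped BigOperators Topology NNReal ENNReal Classical BoundedContinuousFunction unitInterval
open Filter Set MeasureTheory Metric

namespace Summit.CriticalPhenomena.SAWScalingLimit.Theorems.ObservableToSLER.BridgeGate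

open Literature.Probability.LatticeModels (HexVertex hexGraph hexCenter triZeta Site polyline)
open Literature.Probability.RandomPlanarGeometry
open Literature.Probability.RandomPlanarGeometry.SAW

section PerCell

variable {Ω : Set ℂ} {δ r R ρ : ℝ} {a b : HexVertex}

/-- The class of the rescaled polyline through a vertex list. -/
def polyClass (δ : ℝ) (L : List HexVertex) : CurveClass ℂ :=
  CurveClass.mk ⟨polyline (L.map fun v => (δ : ℂ) * hexCenter v)⟩

/-- The curve of a SAW is the class of the rescaled polyline through its support. -/
theorem curve_eq_polyClass {u v : HexVertex} (γ : HexDomainSAW Ω δ u v) :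
    γ.curve = polyClass δ γ.walk.support := rfl

/-- The middle curve of a walk with respect to the label `κ`. -/
def GateLabel.midCurve (κ : GateLabel) (δ : ℝ) {Ω : Set ℂ} {a b : HexVertex}
    (γ : HexDomainSAW Ω δ a b) : CurveClass ℂ :=
  polyClass δ (midList κ.l₁.length κ.l₂.length γ.walk.support)

/-- The carved weight avoiding `S ∪ T` is the critical weight restricted to the walks avoiding `S`
and `T`. -/
theorem carvedWeight_union (S T : Set HexVertex) (u v : HexVertex) :
    carvedWeight Ω δ (S ∪ T) u v =
      (hexSAWWeight Ω δ u v).restrict {ξ | ∀ x ∈ ξ.walk.support, x ∉ S ∧ x ∉ T} := by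
  rw [carvedWeight]
  congr 1
  ext ξ
  simp only [Set.mem_setOf_eq, Set.mem_union, not_or]

/-- **The exact factorisation on a cylinder, pushed to curves**: under `GateDecomposition` for the
cylinder data, the law of the middle curve under the critical weight restricted to the cylinder is
`x_c^{|l₁|+|l₂|}` times the law of the curve under the carved weight. -/
theorem map_midCurve_restrict_cyl (κ : GateLabel) (S T : Set HexVertex)
    (hGD : ∀ B : Set (List HexVertex),
      hexSAWWeight Ω δ a b
          {γ | ∃ mid ∈ B, mid.head? = some κ.q ∧ mid.getLast? = some κ.q' ∧
            (∀ v ∈ mid, v ∉ S ∧ v ∉ T) ∧ γ.walk.support = κ.l₁ ++ mid ++ κ.l₂} =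
        ENNReal.ofReal (hexCriticalFugacity ^ (κ.l₁.length + κ.l₂.length)) *
          hexSAWWeight Ω δ κ.q κ.q'
            {γ | γ.walk.support ∈ B ∧ ∀ v ∈ γ.walk.support, v ∉ S ∧ v ∉ T}) :
    ((hexSAWWeight Ω δ a b).restrict (κ.cyl S T Ω δ a b)).map (κ.midCurve δ) =
      ENNReal.ofReal (hexCriticalFugacity ^ (κ.l₁.length + κ.l₂.length)) •
        (carvedWeight Ω δ (S ∪ T) κ.q κ.q').map (fun ξ => ξ.curve) := by
  refine Measure.ext fun E hE => ?_
  rw [Measure.map_apply (EmbDomainSAW.measurable_of_top _) hE, Measure.smul_apply,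
    Measure.map_apply (EmbDomainSAW.measurable_of_top _) hE,
    Measure.restrict_apply (MeasurableSpace.measurableSet_top), carvedWeight_union,
    Measure.restrict_apply (MeasurableSpace.measurableSet_top), smul_eq_mul]
  have hset1 : κ.midCurve δ ⁻¹' E ∩ κ.cyl S T Ω δ a b =
      {γ | ∃ mid ∈ {mid | polyClass δ mid ∈ E}, mid.head? = some κ.q ∧ mid.getLast? = some κ.q' ∧
        (∀ v ∈ mid, v ∉ S ∧ v ∉ T) ∧ γ.walk.support = κ.l₁ ++ mid ++ κ.l₂} := by
    ext γ
    simp only [Set.mem_inter_iff, Set.mem_preimage, Set.mem_setOf_eq, GateLabel.cyl,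
      GateLabel.midCurve]
    constructor
    · rintro ⟨hγ, mid, hh, hl, hav, hsupp⟩
      refine ⟨mid, ?_, hh, hl, hav, hsupp⟩
      rwa [hsupp, midList_append] at hγ
    · rintro ⟨mid, hmid, hh, hl, hav, hsupp⟩
      refine ⟨?_, mid, hh, hl, hav, hsupp⟩
      rwa [hsupp, midList_append]
  have hset2 : (fun ξ : HexDomainSAW Ω δ κ.q κ.q' => ξ.curve) ⁻¹' E ∩
      {ξ | ∀ x ∈ ξ.walk.support, x ∉ S ∧ x ∉ T} =
      {ξ | ξ.walk.support ∈ {mid | polyClass δ mid ∈ E} ∧ ∀ v ∈ ξ.walk.support, v ∉ S ∧ v ∉ T} := by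
    ext ξ
    simp only [Set.mem_inter_iff, Set.mem_preimage, Set.mem_setOf_eq, curve_eq_polyClass]
  rw [hset1, hset2]
  exact hGD {mid | polyClass δ mid ∈ E}

/-- Integral form of `map_midCurve_restrict_cyl`. -/
theorem setIntegral_cyl_midCurve (κ : GateLabel) (S T : Set HexVertex)
    (hGD : ∀ B : Set (List HexVertex),
      hexSAWWeight Ω δ a b
          {γ | ∃ mid ∈ B, mid.head? = some κ.q ∧ mid.getLast? = some κ.q' ∧
            (∀ v ∈ mid, v ∉ S ∧ v ∉ T) ∧ γ.walk.support = κ.l₁ ++ mid ++ κ.l₂} =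
        ENNReal.ofReal (hexCriticalFugacity ^ (κ.l₁.length + κ.l₂.length)) *
          hexSAWWeight Ω δ κ.q κ.q'
            {γ | γ.walk.support ∈ B ∧ ∀ v ∈ γ.walk.support, v ∉ S ∧ v ∉ T})
    (f : CurveClass ℂ →ᵇ ℝ) :
    ∫ γ in κ.cyl S T Ω δ a b, f (κ.midCurve δ γ) ∂(hexSAWWeight Ω δ a b) =
      hexCriticalFugacity ^ (κ.l₁.length + κ.l₂.length) *
        ∫ ξ, f ξ.curve ∂(carvedWeight Ω δ (S ∪ T) κ.q κ.q') := by
  have h1 : ∫ γ in κ.cyl S T Ω δ a b, f (κ.midCurve δ γ) ∂(hexSAWWeight Ω δ a b) =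
      ∫ y, f y ∂(((hexSAWWeight Ω δ a b).restrict (κ.cyl S T Ω δ a b)).map (κ.midCurve δ)) :=
    (integral_map (EmbDomainSAW.measurable_of_top _).aemeasurable
      f.continuous.aestronglyMeasurable).symm
  have h2 : ∫ ξ, f ξ.curve ∂(carvedWeight Ω δ (S ∪ T) κ.q κ.q') =
      ∫ y, f y ∂((carvedWeight Ω δ (S ∪ T) κ.q κ.q').map (fun ξ => ξ.curve)) :=
    (integral_map (EmbDomainSAW.measurable_of_top _).aemeasurable
      f.continuous.aestronglyMeasurable).symm
  rw [h1, h2, map_midCurve_restrict_cyl κ S T hGD, integral_smul_measure,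
    ENNReal.toReal_ofReal (pow_nonneg hexCriticalFugacity_pos_lt_one.1.le _), smul_eq_mul]

/-- Mass form of `map_midCurve_restrict_cyl`. -/
theorem measure_cyl (κ : GateLabel) (S T : Set HexVertex)
    (hGD : ∀ B : Set (List HexVertex),
      hexSAWWeight Ω δ a b
          {γ | ∃ mid ∈ B, mid.head? = some κ.q ∧ mid.getLast? = some κ.q' ∧
            (∀ v ∈ mid, v ∉ S ∧ v ∉ T) ∧ γ.walk.support = κ.l₁ ++ mid ++ κ.l₂} =
        ENNReal.ofReal (hexCriticalFugacity ^ (κ.l₁.length + κ.l₂.length)) *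
          hexSAWWeight Ω δ κ.q κ.q'
            {γ | γ.walk.support ∈ B ∧ ∀ v ∈ γ.walk.support, v ∉ S ∧ v ∉ T}) :
    hexSAWWeight Ω δ a b (κ.cyl S T Ω δ a b) =
      ENNReal.ofReal (hexCriticalFugacity ^ (κ.l₁.length + κ.l₂.length)) *
        carvedWeight Ω δ (S ∪ T) κ.q κ.q' Set.univ := by
  have h := congrArg (fun μ : Measure (CurveClass ℂ) => μ Set.univ)
    (map_midCurve_restrict_cyl κ S T hGD)
  simp only [Measure.map_apply (EmbDomainSAW.measurable_of_top _) MeasurableSet.univ,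
    Set.preimage_univ, Measure.restrict_apply MeasurableSet.univ, Set.univ_inter,
    Measure.smul_apply, smul_eq_mul] at h
  exact h

/-- The total critical weight between two vertices is finite (finitely many SAWs). -/
theorem hexSAWWeight_ne_top {u v : HexVertex} [Finite (HexDomainSAW Ω δ u v)]
    (s : Set (HexDomainSAW Ω δ u v)) : hexSAWWeight Ω δ u v s ≠ ∞ := by
  classical
  haveI := Fintype.ofFinite (HexDomainSAW Ω δ u v)
  refine ne_top_of_le_ne_top ?_ (measure_mono (Set.subset_univ s))
  show embWeight hexGraph hexCenter Ω δ hexCriticalFugacity u v Set.univ ≠ ∞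
  rw [embWeight, Measure.sum_apply _ MeasurableSpace.measurableSet_top, tsum_fintype]
  simp only [Measure.smul_apply, smul_eq_mul, Measure.dirac_apply_of_mem (Set.mem_univ _), mul_one]
  exact ENNReal.sum_ne_top.2 fun _ _ => ENNReal.ofReal_ne_top

/-- **Per-cell identity**: on a cylinder, the `hexSAWLaw`-integral of `f` of the middle curve is
the mass of the cylinder times the carved-law integral of `f ∘ curve`. -/
theorem setIntegral_cyl_midCurve_law (κ : GateLabel) (S T : Set HexVertex)
    [Finite (HexDomainSAW Ω δ κ.q κ.q')]
    (hGD : ∀ B : Set (List HexVertex),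
      hexSAWWeight Ω δ a b
          {γ | ∃ mid ∈ B, mid.head? = some κ.q ∧ mid.getLast? = some κ.q' ∧
            (∀ v ∈ mid, v ∉ S ∧ v ∉ T) ∧ γ.walk.support = κ.l₁ ++ mid ++ κ.l₂} =
        ENNReal.ofReal (hexCriticalFugacity ^ (κ.l₁.length + κ.l₂.length)) *
          hexSAWWeight Ω δ κ.q κ.q'
            {γ | γ.walk.support ∈ B ∧ ∀ v ∈ γ.walk.support, v ∉ S ∧ v ∉ T})
    (f : CurveClass ℂ →ᵇ ℝ) :
    ∫ γ in κ.cyl S T Ω δ a b, f (κ.midCurve δ γ) ∂(hexSAWLaw Ω δ a b) =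
      (hexSAWLaw Ω δ a b).real (κ.cyl S T Ω δ a b) *
        ∫ ξ, f ξ.curve ∂(carvedLaw Ω δ (S ∪ T) κ.q κ.q') := by
  have hx0 : 0 ≤ hexCriticalFugacity ^ (κ.l₁.length + κ.l₂.length) :=
    pow_nonneg hexCriticalFugacity_pos_lt_one.1.le _
  have hlaw : hexSAWLaw Ω δ a b = (hexSAWWeight Ω δ a b Set.univ)⁻¹ • hexSAWWeight Ω δ a b := rfl
  have hcl : carvedLaw Ω δ (S ∪ T) κ.q κ.q' =
      (carvedWeight Ω δ (S ∪ T) κ.q κ.q' Set.univ)⁻¹ • carvedWeight Ω δ (S ∪ T) κ.q κ.q' := rfl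
  have hfin : carvedWeight Ω δ (S ∪ T) κ.q κ.q' Set.univ ≠ ∞ := by
    rw [carvedWeight]
    exact ne_top_of_le_ne_top (hexSAWWeight_ne_top Set.univ) (Measure.restrict_le_self _)
  rw [hlaw, Measure.restrict_smul, integral_smul_measure, setIntegral_cyl_midCurve κ S T hGD f,
    measureReal_def, Measure.smul_apply, measure_cyl κ S T hGD, hcl, integral_smul_measure]
  simp only [smul_eq_mul, ENNReal.toReal_mul, ENNReal.toReal_ofReal hx0]
  rcases eq_or_ne (carvedWeight Ω δ (S ∪ T) κ.q κ.q' Set.univ) 0 with h0 | h0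
  · have hcW0 : carvedWeight Ω δ (S ∪ T) κ.q κ.q' = 0 := Measure.measure_univ_eq_zero.1 h0
    simp [hcW0]
  · have hne : (carvedWeight Ω δ (S ∪ T) κ.q κ.q' Set.univ).toReal ≠ 0 :=
      ENNReal.toReal_ne_zero.2 ⟨h0, hfin⟩
    simp only [ENNReal.toReal_inv]
    generalize (carvedWeight Ω δ (S ∪ T) κ.q κ.q' Set.univ).toReal = c at hne ⊢
    field_simp

end PerCell

end Summit.CriticalPhenomena.SAWScalingLimit.Theorems.ObservableToSLER.BridgeGate

namespace Summit.CriticalPhenomena.SAWScalingLimit.Theorems.ObservableToSLER.BridgeGate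

open Literature.Probability.LatticeModels (HexVertex hexGraph hexCenter triZeta Site)
open Literature.Probability.RandomPlanarGeometry
open Literature.Probability.RandomPlanarGeometry.SAW

/-- **Registered sub-goal `stub_perCellIdentity`** (self-contained form of `setIntegral_cyl_midCurve_law`). -/
theorem stub_perCellIdentity : ∀ (Ω : Set ℂ) (δ : ℝ) (a b : HexVertex) (κ : GateLabel) (S T : Set HexVertex) (f : CurveClass ℂ →ᵇ ℝ) [Finite (HexDomainSAW Ω δ κ.q κ.q')], (∀ B : Set (List HexVertex), hexSAWWeight Ω δ a b {γ | ∃ mid ∈ B, mid.head? = some κ.q ∧ mid.getLast? = some κ.q' ∧ (∀ v ∈ mid, v ∉ S ∧ v ∉ T) ∧ γ.walk.support = κ.l₁ ++ mid ++ κ.l₂} = ENNReal.ofReal (hexCriticalFugacity ^ (κ.l₁.length + κ.l₂.length)) * hexSAWWeight Ω δ κ.q κ.q' {γ | γ.walk.support ∈ B ∧ ∀ v ∈ γ.walk.support, v ∉ S ∧ v ∉ T}) → ∫ γ in κ.cyl S T Ω δ a b, f (κ.midCurve δ γ) ∂(hexSAWLaw Ω δ a b) = (hexSAWLaw Ω δ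 a b).real (κ.cyl S T Ω δ a b) * ∫ ξ, f ξ.curve ∂(carvedLaw Ω δ (S ∪ T) κ.q κ.q') :=
  fun _ _ _ _ κ S T f _ hGD => setIntegral_cyl_midCurve_law κ S T hGD f

end Summit.CriticalPhenomena.SAWScalingLimit.Theorems.ObservableToSLER.BridgeGate

end
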